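import Summits.ResolutionOfSingularities.ResolutionOfSingularities.Theses.HilbertSamuelElimination

/-!
# `ModificationsResolve` (crux stmt-ResolutionOfSingularities-18507, route `HilbertSamuelElimination`):
# the isomorphism half of (ME1) in its hypothesis `SigmaMaxModifications` is load-bearing
# (negative-side support, refuter cdisprove seat; this file does NOT refute the crux)

The crux is definitionally `E → S` with `E = SigmaMaxModifications` (crux 2) and
`S = ResolutionOfSingularities` (the summit), so `¬ crux ↔ E ∧ ¬ S` and no `_false_without_`
lemma can exist (its conclusion would be `¬ S`). The sharpest load-bearing statement available is
recorded here, sorry-free and definition-free (the weakened hypothesis `E⁻` = `E` with the single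
conjunct `∀ U ⊆ X ∖ X_max, IsIso (π ∣_ U)` deleted — the dense-preimage half of (ME1), (ME2), the
monotonicity of `H` and everything else kept verbatim — is written inline each time):

* `sigmaMaxModifications_imp_without_iso` — `E → E⁻` (sanity: `E⁻` is a weakening of `E`);
* `sigmaMaxModifications_without_iso_holds` — `E⁻` is TRUE, witnessed by the EMPTY modification
  `∅ → X` (proper: a closed immersion; `∅` is reduced of dimension `⊥`; dense preimage,
  monotonicity and (ME2) are vacuous on the empty scheme / the empty value set);
* `modificationsResolve_without_iso_iff` — consequently `(E⁻ → ∀ p prime, ResolutionInChar p)`,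
  i.e. the crux with that clause deleted from its hypothesis, is EQUIVALENT to the summit.

Moral for provers of crux 3: the proof must use the isomorphism clause (in the lead's line it
enters through `IsBirational π`, `Scheme.HasResolution.of_isBirational` and the dimension bound
`dim X' ≤ dim X`); for the planner: (ME1)-iso is exactly what makes crux 2 non-vacuous.
-/

noncomputable section

set_option linter.dupNamespace false

namespace Summit.ResolutionOfSingularities.ResolutionOfSingularities.Theorems.ModificationsResolve.Negative

open CategoryTheory AlgebraicGeometry TopologicalSpace
open Summit.ResolutionOfSingularities.ResolutionOfSingularities.Theses.HilbertSamuelElimination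

/-- Sanity: `E⁻` (the conjunct `∀ U ⊆ X ∖ X_max, IsIso (π ∣_ U)` deleted) is a weakening of
`SigmaMaxModifications`. -/
theorem sigmaMaxModifications_imp_without_iso (hE : SigmaMaxModifications) :
      ∀ p : ℕ, p.Prime → ∀ (k : Type) [Field k] [CharP k p] (X : AlgebraicGeometry.Scheme.{0}) (f : X ⟶ AlgebraicGeometry.Spec (.of k)), AlgebraicGeometry.IsSeparated f → AlgebraicGeometry.LocallyOfFiniteType f → AlgebraicGeometry.QuasiCompact f → AlgebraicGeometry.IsReduced X → ¬ Literature.AlgebraicGeometry.Resolution.Scheme.IsRegular X → ∀ N : ℕ, topologicalKrullDim X ≤ (N : WithBot ℕ∞) → let H : (Y : AlgebraicGeometry.Scheme.{0}) → Y → ℕ → ℕ := fun Y y => Literature.RingTheory.HilbertSamuel.hilbertSamuelFun (Y.presheaf.stalk y) (N - Literature.RingTheory.HilbertSamuel.minimalPrimesCodim (Y.presheaf.stalk y)); ∃ (X' : AlgebraicGeometry.Scheme.{0}) (π : X' ⟶ X), AlgebraicGeometry.IsProper π ∧ AlgebraicGeometry.IsReduced X' ∧ topologicalKrullDim X' ≤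 (N : WithBot ℕ∞) ∧ Dense ((fun x' => π.base x') ⁻¹' {x | Maximal (· ∈ Set.range (H X)) (H X x)}ᶜ) ∧ (∀ x' : X', H X' x' ≤ H X (π.base x')) ∧ ∀ ν : ℕ → ℕ, Maximal (· ∈ Set.range (H X)) ν → ν ∉ Set.range (H X') := by
  intro p hp k _ _ X f hs hl hq hr hX N hN
  obtain ⟨X', π, h1, h2, h3, -, h5, h6, h7⟩ := hE p hp k X f hs hl hq hr hX N hN
  exact ⟨X', π, h1, h2, h3, h5, h6, h7⟩

/-- **Without the isomorphism clause, `SigmaMaxModifications` is trivially true**: the empty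
modification `∅ → X` satisfies every remaining clause. -/
theorem sigmaMaxModifications_without_iso_holds :
      ∀ p : ℕ, p.Prime → ∀ (k : Type) [Field k] [CharP k p] (X : AlgebraicGeometry.Scheme.{0}) (f : X ⟶ AlgebraicGeometry.Spec (.of k)), AlgebraicGeometry.IsSeparated f → AlgebraicGeometry.LocallyOfFiniteType f → AlgebraicGeometry.QuasiCompact f → AlgebraicGeometry.IsReduced X → ¬ Literature.AlgebraicGeometry.Resolution.Scheme.IsRegular X → ∀ N : ℕ, topologicalKrullDim X ≤ (N : WithBot ℕ∞) → let H : (Y : AlgebraicGeometry.Scheme.{0}) → Y → ℕ → ℕ := fun Y y => Literature.RingTheory.HilbertSamuel.hilbertSamuelFun (Y.presheaf.stalk y) (N - Literature.RingTheory.HilbertSamuel.minimalPrimesCodim (Y.presheaf.stalk y)); ∃ (X' : AlgebraicGeometry.Scheme.{0}) (π : X' ⟶ X), AlgebraicGeometry.IsProper π ∧ AlgebraicGeometry.IsReduced X' ∧ topologicalKrullDim X' ≤ (N : WithBot ℕ∞) ∧ Dense ((fun x' => π.base x') ⁻¹' {x | Maximal (· ∈ Set.range (H X)) (H X x)}ᶜ)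 ∧ (∀ x' : X', H X' x' ≤ H X (π.base x')) ∧ ∀ ν : ℕ → ℕ, Maximal (· ∈ Set.range (H X)) ν → ν ∉ Set.range (H X') := by
  intro p hp k _ _ X f hs hl hq hr hX N hN
  have hdim : topologicalKrullDim (∅ : Scheme.{0}) = ⊥ := by
    unfold topologicalKrullDim
    haveI : IsEmpty (IrreducibleCloseds (∅ : Scheme.{0})) :=
      ⟨fun Z => isEmptyElim Z.2.nonempty.some⟩
    exact Order.krullDim_eq_bot
  refine ⟨∅, Scheme.emptyTo X, inferInstance, ?_, ?_, ?_, ?_, ?_⟩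
  · exact @isReduced_of_isReduced_stalk _ (fun x => isEmptyElim x)
  · rw [hdim]; exact bot_le
  · intro x; exact isEmptyElim x
  · intro x; exact isEmptyElim x
  · rintro ν - ⟨x, -⟩; exact isEmptyElim x

/-- **The crux with (ME1)-iso deleted from its hypothesis is the summit itself.** -/
theorem modificationsResolve_without_iso_iff :
    ((∀ p : ℕ, p.Prime → ∀ (k : Type) [Field k] [CharP k p] (X : AlgebraicGeometry.Scheme.{0}) (f : X ⟶ AlgebraicGeometry.Spec (.of k)), AlgebraicGeometry.IsSeparated f → AlgebraicGeometry.LocallyOfFiniteType f → AlgebraicGeometry.QuasiCompact f → AlgebraicGeometry.IsReduced X → ¬ Literature.AlgebraicGeometry.Resolution.Scheme.IsRegular X → ∀ N : ℕ, topologicalKrullDim X ≤ (N : WithBot ℕ∞) → let H : (Y : AlgebraicGeometry.Scheme.{0}) → Y → ℕ → ℕ := fun Y y => Literature.RingTheory.HilbertSamuel.hilbertSamuelFun (Y.presheaf.stalk y) (N - Literature.RingTheory.HilbertSamuel.minimalPrimesCodim (Y.presheaf.stalk y)); ∃ (X' : AlgebraicGeometry.Scheme.{0}) (π : X' ⟶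 X), AlgebraicGeometry.IsProper π ∧ AlgebraicGeometry.IsReduced X' ∧ topologicalKrullDim X' ≤ (N : WithBot ℕ∞) ∧ Dense ((fun x' => π.base x') ⁻¹' {x | Maximal (· ∈ Set.range (H X)) (H X x)}ᶜ) ∧ (∀ x' : X', H X' x' ≤ H X (π.base x')) ∧ ∀ ν : ℕ → ℕ, Maximal (· ∈ Set.range (H X)) ν → ν ∉ Set.range (H X')) →
      ∀ p : ℕ, p.Prime → Literature.AlgebraicGeometry.Resolution.ResolutionInChar.{0} p) ↔
    _root_.ResolutionOfSingularities :=
  ⟨fun h => h sigmaMaxModifications_without_iso_holds, fun hS _ => hS⟩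

end Summit.ResolutionOfSingularities.ResolutionOfSingularities.Theorems.ModificationsResolve.Negative

end
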